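import Mathlib
import Summits.NavierStokesRegularity.NavierStokesRegularity.Theorems.LerayQuarterDissipationFiniteDissipationLiouvilleVorticityLThreeStretching
import HarnessLib

/-!
# Crux `FiniteDissipationLiouville` (stmt-NavierStokesRegularity-22144): the `L³`-VORTICITY
# threshold — a finite-dissipation Type-I profile with `KS²·(−t)‖curl V(t)‖²_{L³} < 3` for all
# `t < 0` is trivial (file 3/3)

Theorems file of route `LerayQuarterDissipation` (lead prover g16; `--supports` the crux; portrait
fact for the registered stub `stub_envelopeCriticalLiouville` of skeleton `Lines/birth.lean`).
Navier–Stokes regularity is NOT proved by anything here; no summit is.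

`𝒟_{C,K}`: Type-I ancient mild fields `V` in the KNSS gauge (`IsTypeIAncientMild C V`: smooth on
`t < 0`, divergence free, Oseen-mild, `‖V(t,x)‖ ≤ C/√(−t)`) whose slices obey the quarter-rate
dissipation law `∫ ‖DV(t)‖² ≤ K/√(−t)`. The stratum carries, next to `C` (`L^∞` of the velocity),
`K` (`L²` of the gradient) and the vorticity amplitude `C_ω = sup(−t)‖curl V‖` (`L^∞` of the
vorticity; lead g15), a FOURTH scale-invariant parameter, the `L³`-VORTICITY constant
  `V₃ = sup_{t<0} √(−t)·‖curl V(t)‖_{L³(ℝ³)}`   (in similarity variables `sup_s ‖Ω(s)‖_{L³}`),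
finite on the stratum (`‖Ω‖₃³ ≤ ‖Ω‖_∞‖Ω‖₂²`). This file proves the EXPLICIT rung in it, with
`KS = SNormLESNormFDerivOfEqConst ℝ³ volume 2` Mathlib's Gagliardo–Nirenberg–Sobolev constant
(`‖g‖₆ ≤ KS‖Dg‖₂`):

* `lerayVorticity_eq_zero_of_vorticityLThree_lt`, **`eq_zero_of_vorticityLThree_lt`** — a member
  of `𝒟_{C,K}` (ANY `C`, ANY `K`) with `∫⁻‖curl V(t)‖ₑ³ ≤ v³/(√(−t))³` for all `t < 0` and
  `KS²v² < 3` vanishes identically on `t < 0`. Mechanism: the stretching term of the localised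
  similarity-enstrophy budget priced `L² × L³ × L⁶` (file 2/3,
  `two_mul_integral_sqCutoff_stretching_le_cubic`: trace-free kinematics, Hölder, Sobolev on
  `φ_RΩ`), the dissipation consumed EXACTLY by the Sobolev step, leaves
  `Z_R' ≤ −½Z_R + ((1+δ)KS²v²/6)·m + LM/R`; the backward ODE bound on the ancient orbit and
  `R → ∞` improve a uniform bound `Z_∞ ≤ m` to `((1+δ)KS²v²/3)·m` (file 1/3); iterate.
* `not_singular_of_vorticityLThree_lt`, **`vorticityLThree_exceeds_of_singular`** — regularity
  form and PORTRAIT: a SINGULAR member of the stratum has, for every `v ≥ 0` with `KS²v² < 3`, an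
  instant `t < 0` with `(√(−t))³∫‖curl V(t)‖³ > v³`, i.e. `sup_t √(−t)‖ω(t)‖_{L³} ≥ √3/KS`.
* **`eq_zero_of_vorticity_mul_dissipation_lt`**, `vorticity_mul_dissipation_ge_of_singular` — THE
  HYPERBOLA: by the interpolation `‖Ω‖₃³ ≤ ‖Ω‖_∞‖Ω‖₂²`
  (`integrable_cube_norm_lerayVorticity_of_vorticity_le`) the `L³` rung contains the PRODUCT region
  `KS⁶(C_ω‖curlCLM‖² max K 0)² < 27`, i.e. `C_ω·K < 3√3/(KS³‖curlCLM‖²)`, of the `(K, C_ω)` plane —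
  a region under a hyperbola, inside neither of the tree's strips `{θ(K)⁴ < 64/27}` (any `C_ω`) and
  `{C_ω < √3/4}` (any `K`): large dissipation with small vorticity amplitude, or conversely, is
  excluded as long as the product is small. A singular member has `C_ω·K ≥ 3√3/(KS³‖curlCLM‖²)`.

Position in the family of explicit thresholds of the line: velocity `√(−t)‖V‖_∞ ≥ 1` (T31⁗ /
`…ThresholdOne`), dissipation `θ(K)⁴ ≥ 64/27` (`…SmallDissipationGapSharper` / `…ThresholdK`, an
`L²`-level quantity), vorticity amplitude `(−t)‖ω‖_∞ ≥ √3/4` (`…VorticityAmplitude`), and now the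
`L³` level `√(−t)‖ω‖₃ ≥ √3/KS` — the Hölder pairing `(3,6)` of the stretching density `|Ω|²|S|`
between the pairings `(4,4)` (Ladyzhenskaya, `K`) and `(∞,2)` (`C_ω`).

HONEST FRAMING. An explicit necessary condition on the HYPOTHETICAL singular profile with
Mathlib's non-sharp Sobolev constant (with the sharp Aubin–Talenti constant `KS² = (4/3)·2^{−2/3}
·π^{−4/3}… ` the number would improve; not attempted); `L³`-smallness of the vorticity is neither
implied by nor implies the `L^∞` (`C_ω`) or `L²` (`K`) smallness already in the tree; nothing is
removed from the catalogued DSS wall (`TypeIDSSLiouville`, NECESSARY for the crux); nothing here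
bears on Navier–Stokes regularity or blow-up.

References: Koch–Nadirashvili–Seregin–Šverák, Acta Math. 203 (2009) §4–§6 (class, gauge);
Beale–Kato–Majda, Comm. Math. Phys. 94 (1984) and Kozono–Taniuchi, Comm. Math. Phys. 214 (2000)
(vorticity norms controlling blow-up, implicit constants); Evans 2010 §5.6.1 (GNS); folklore energy
method.
-/

noncomputable section

set_option linter.dupNamespace false

namespace Summit.NavierStokesRegularity.NavierStokesRegularity.Theorems.FiniteDissipationLiouville.VorticityLThree

open MeasureTheory Set Filter Topology Metric InnerProductSpace Function Real
open scoped RealInnerProductSpace ContDiff ENNReal Laplacian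
open Literature.Analysis Literature.Analysis.FluidPDE
open Summit.NavierStokesRegularity.NavierStokesRegularity.Theorems
open Summit.NavierStokesRegularity.NavierStokesRegularity.Theorems.GaussianGap
open Summit.NavierStokesRegularity.NavierStokesRegularity.Theorems.SimilarityEnstrophy
open Summit.NavierStokesRegularity.NavierStokesRegularity.Theorems.SmallDissipationGap
open Summit.NavierStokesRegularity.NavierStokesRegularity.Theorems.FiniteDissipationLiouville.VorticityAmplitude

variable {C : ℝ} {V : ℝ → (EuclideanSpace ℝ (Fin 3)) → (EuclideanSpace ℝ (Fin 3))}

/-! ### The core in similarity variables: `‖Ω(s)‖₃ ≤ v`, `KS²v² < 3` forces `Ω ≡ 0` -/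

section Core

/-- **The similarity vorticity vanishes below the `L³`-vorticity threshold (similarity form).** For
`V ∈ 𝒟_{C,K}` (any `C`, any `K`) whose similarity vorticity slices satisfy `‖Ω(σ)‖³ ∈ L¹`,
`∫‖Ω(σ)‖³ ≤ v³` for all `σ` (`v ≥ 0`) with `KS²v² < 3`: `Ω ≡ 0`. With `q = KS²v²`,
`δ = (3 − q)/(3 + q)` the contraction ratio is `r = (1+δ)q/3 = 2q/(3+q) < 1`, and
`∫‖Ω(s)‖² ≤ rⁿ·‖curlCLM‖²·max K 0 → 0` (`two_mul_integral_sqCutoff_stretching_le_cubic` +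
`integral_sq_norm_lerayVorticity_le_of_forall_one_le`). [folklore energy method; Gagliardo–Nirenberg–Sobolev] -/
theorem lerayVorticity_eq_zero_of_cube_le (hV : IsTypeIAncientMild C V) {K : ℝ}
    (hK : ∀ t : ℝ, t < 0 → ∫⁻ x, ‖fderiv ℝ (V t) x‖ₑ ^ 2 ≤ ENNReal.ofReal (K / Real.sqrt (-t)))
    {v : ℝ} (hv0 : 0 ≤ v)
    (hv : (SNormLESNormFDerivOfEqConst (EuclideanSpace ℝ (Fin 3))
        (volume : Measure (EuclideanSpace ℝ (Fin 3))) 2 : ℝ) ^ 2 * v ^ 2 < 3)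
    (hΩ3 : ∀ σ : ℝ, Integrable (fun y => ‖lerayVorticity V σ y‖ ^ 3) ∧
      ∫ y, ‖lerayVorticity V σ y‖ ^ 3 ≤ v ^ 3) :
    ∀ s y, lerayVorticity V s y = 0 := by
  set KS : ℝ := (SNormLESNormFDerivOfEqConst (EuclideanSpace ℝ (Fin 3))
        (volume : Measure (EuclideanSpace ℝ (Fin 3))) 2 : ℝ) with hKSdef
  have hΩi := fun σ => integrable_sq_norm_lerayVorticity hV hK σ
  obtain ⟨c₁, hc₁0, hc₁⟩ :=
    exists_norm_fderiv_smoothTransition_cutoff_le (E := (EuclideanSpace ℝ (Fin 3)))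
  set M : ℝ := ‖curlCLM‖ ^ 2 * max K 0 with hMdef
  set q : ℝ := KS ^ 2 * v ^ 2 with hqdef
  have hq0 : 0 ≤ q := by positivity
  have hq3 : q < 3 := hv
  -- the product-rule weight and the contraction ratio
  set δ : ℝ := (3 - q) / (3 + q) with hδdef
  have hδ : 0 < δ := div_pos (by linarith) (by linarith)
  set b : ℝ := (1 + δ) * KS ^ 2 * v ^ 2 / 6 with hbdef
  have hb0 : 0 ≤ b := by positivity
  set r : ℝ := 2 * (0 + b) with hrdef
  have hr0 : 0 ≤ r := by positivity
  have hr1 : r < 1 := by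
    have h3q : (3 + q) ≠ 0 := by positivity
    have e : r = 2 * q / (3 + q) := by
      rw [hrdef, hbdef, hδdef,
        show (1 + (3 - q) / (3 + q)) * KS ^ 2 * v ^ 2 / 6 = (1 + (3 - q) / (3 + q)) * q / 6 by
          rw [hqdef]; ring]
      field_simp
      ring
    rw [e, div_lt_one (by linarith)]
    linarith
  have hstr : ∀ σ : ℝ, ∀ R : ℝ, 1 ≤ R →
      2 * (∫ y, smoothTransition (2 - ‖y‖ ^ 2 / R ^ 2) ^ 2 *
        ⟪fderiv ℝ (lerayOrbit V σ) y (lerayVorticity V σ y), lerayVorticity V σ y⟫) ≤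
        2 * (∫ y, smoothTransition (2 - ‖y‖ ^ 2 / R ^ 2) ^ 2 *
            frobeniusNormSq (fderiv ℝ (lerayVorticity V σ) y)) +
          0 * (∫ y, smoothTransition (2 - ‖y‖ ^ 2 / R ^ 2) ^ 2 * ‖lerayVorticity V σ y‖ ^ 2) +
          b * (∫ y, ‖lerayVorticity V σ y‖ ^ 2) +
          (2 * c₁ ^ 2 / δ) / R *
            ∫ y in closedBall (0 : EuclideanSpace ℝ (Fin 3)) (2 * R), ‖lerayVorticity V σ y‖ ^ 2 :=
    fun σ R hR1 => two_mul_integral_sqCutoff_stretching_le_cubic hV hK hc₁ hR1 σ hv0 (hΩ3 σ).1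
      (hΩ3 σ).2 hδ
  have hiter : ∀ n : ℕ, ∀ s, ∫ y, ‖lerayVorticity V s y‖ ^ 2 ≤ r ^ n * M := by
    intro n
    induction n with
    | zero => intro s; rw [pow_zero, one_mul]; exact (hΩi s).2
    | succ n ih =>
        intro s
        calc ∫ y, ‖lerayVorticity V s y‖ ^ 2 ≤ 2 * (0 + b) * (r ^ n * M) :=
              integral_sq_norm_lerayVorticity_le_of_forall_one_le hV hK le_rfl hb0
                (by positivity) hstr ih s
          _ = r ^ (n + 1) * M := by rw [hrdef]; ring
  have hlim : Tendsto (fun n : ℕ => r ^ n * M) atTop (𝓝 (0 * M)) :=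
    (tendsto_pow_atTop_nhds_zero_of_lt_one hr0 hr1).mul_const M
  rw [zero_mul] at hlim
  intro s
  have hcΩ : Continuous (lerayVorticity V s) :=
    (signedBudget_contDiff_lerayVorticity_slice hV s (n := 1)).continuous
  have hE0 : ∫ y, ‖lerayVorticity V s y‖ ^ 2 ≤ 0 := ge_of_tendsto' hlim fun n => hiter n s
  have hE : ∫ y, ‖lerayVorticity V s y‖ ^ 2 = 0 :=
    le_antisymm hE0 (integral_nonneg fun y => sq_nonneg _)
  have hae : (fun y => ‖lerayVorticity V s y‖ ^ 2) =ᵐ[volume] 0 :=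
    (integral_eq_zero_iff_of_nonneg (fun y => sq_nonneg _) (hΩi s).1).1 hE
  have hev : (fun y => ‖lerayVorticity V s y‖ ^ 2) = fun _ => (0 : ℝ) :=
    ((hcΩ.norm.pow 2).ae_eq_iff_eq (μ := volume) continuous_const).1 hae
  intro y
  have hy := congrFun hev y
  have : ‖lerayVorticity V s y‖ = 0 := pow_eq_zero_iff (n := 2) (by norm_num) |>.1 hy
  exact norm_eq_zero.1 this

/-- **Zero similarity vorticity kills a class member.** If `Ω ≡ 0` then `V ≡ 0` on `t < 0`: every
slice is curl- and divergence-free and bounded, hence constant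
(`eq_of_curl_eq_zero_of_isDivFree_of_bounded`), and the Oseen gauge kills constants
(`IsTypeIAncientMild.eq_zero_of_slice_const`) (the ending of lead g15's
`…VorticityAmplitude.eq_zero_of_vorticity_lt`, factored out). [folklore] -/
theorem eq_zero_of_lerayVorticity_eq_zero (hV : IsTypeIAncientMild C V)
    (hΩ0 : ∀ s y, lerayVorticity V s y = 0) : ∀ t < 0, ∀ x, V t x = 0 := by
  have hcurl : ∀ t < 0, ∀ x, curl (V t) x = 0 := by
    intro t ht x
    set s : ℝ := -Real.log (-t) with hs
    have hts : -Real.exp (-s) = t := by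
      rw [hs, neg_neg, Real.exp_log (neg_pos.2 ht), neg_neg]
    have h := hΩ0 s ((Real.exp (-s / 2))⁻¹ • x)
    rw [lerayVorticity_apply, curl_lerayOrbit, smul_smul,
      mul_inv_cancel₀ (Real.exp_pos _).ne', one_smul, hts, smul_eq_zero] at h
    exact h.resolve_left (Real.exp_pos _).ne'
  have hconst : ∀ t < 0, ∀ x, V t x = V t 0 := fun t ht x =>
    eq_of_curl_eq_zero_of_isDivFree_of_bounded ((hV.contDiff_slice ht).of_le (by norm_cast))
      (hcurl t ht) (hV.isDivFree ht) (fun z => hV.norm_le ht z) x 0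
  exact fun t ht x => hV.eq_zero_of_slice_const (b := fun t => V t 0) hconst ht x

end Core

/-! ### The rung in the physical `L³`-vorticity parameter -/

section Rung

/-- **The `L³`-vorticity rung of the finite-dissipation stratum.** A Type-I ancient mild solution
`V` in the KNSS gauge (any constant `C`) obeying the quarter-rate dissipation law (any constant `K`)
whose vorticity satisfies `∫⁻ ‖curl V(t)‖ₑ³ ≤ v³/(√(−t))³` for all `t < 0` — i.e.
`√(−t)‖curl V(t)‖_{L³} ≤ v`, `v ≥ 0` — with `KS²v² < 3` vanishes identically on `t < 0`
(`integrable_cube_norm_lerayVorticity` + `lerayVorticity_eq_zero_of_cube_le` +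
`eq_zero_of_lerayVorticity_eq_zero`). HONEST FRAMING: a Liouville statement about a HYPOTHETICAL
class with an explicit but unoptimised constant (Mathlib's GNS constant); nothing here bears on NS
regularity. [folklore energy method] -/
theorem eq_zero_of_vorticityLThree_lt (hV : IsTypeIAncientMild C V) {K : ℝ}
    (hK : ∀ t : ℝ, t < 0 → ∫⁻ x, ‖fderiv ℝ (V t) x‖ₑ ^ 2 ≤ ENNReal.ofReal (K / Real.sqrt (-t)))
    {v : ℝ} (hv0 : 0 ≤ v)
    (hv : (SNormLESNormFDerivOfEqConst (EuclideanSpace ℝ (Fin 3))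
        (volume : Measure (EuclideanSpace ℝ (Fin 3))) 2 : ℝ) ^ 2 * v ^ 2 < 3)
    (hω : ∀ t : ℝ, t < 0 → ∫⁻ x, ‖curl (V t) x‖ₑ ^ 3 ≤ ENNReal.ofReal (v ^ 3 / Real.sqrt (-t) ^ 3)) :
    ∀ t < 0, ∀ x, V t x = 0 :=
  eq_zero_of_lerayVorticity_eq_zero hV (lerayVorticity_eq_zero_of_cube_le hV hK hv0 hv
    fun σ => integrable_cube_norm_lerayVorticity hV hv0 hω σ)

/-- **Regularity form.** Under the same hypotheses `V` is bounded on a backward parabolic cylinder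
at the space–time origin (indeed `V ≡ 0`), in the quantifier shape of the crux
`FiniteDissipationLiouville`. [folklore] -/
theorem not_singular_of_vorticityLThree_lt (hV : IsTypeIAncientMild C V) {K : ℝ}
    (hK : ∀ t : ℝ, t < 0 → ∫⁻ x, ‖fderiv ℝ (V t) x‖ₑ ^ 2 ≤ ENNReal.ofReal (K / Real.sqrt (-t)))
    {v : ℝ} (hv0 : 0 ≤ v)
    (hv : (SNormLESNormFDerivOfEqConst (EuclideanSpace ℝ (Fin 3))
        (volume : Measure (EuclideanSpace ℝ (Fin 3))) 2 : ℝ) ^ 2 * v ^ 2 < 3)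
    (hω : ∀ t : ℝ, t < 0 → ∫⁻ x, ‖curl (V t) x‖ₑ ^ 3 ≤ ENNReal.ofReal (v ^ 3 / Real.sqrt (-t) ^ 3)) :
    ¬ (∀ r > 0, ∀ M : ℝ, ∃ t ∈ Set.Ioo (-(r ^ 2)) (0 : ℝ),
        ∃ x ∈ Metric.ball (0 : EuclideanSpace ℝ (Fin 3)) r, M < ‖V t x‖) := by
  intro hsing
  obtain ⟨t, ht, x, -, hM⟩ := hsing 1 one_pos 0
  have h0 := eq_zero_of_vorticityLThree_lt hV hK hv0 hv hω t ht.2 x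
  rw [h0, norm_zero] at hM
  exact lt_irrefl _ hM

/-- **PORTRAIT: the `L³` norm of the vorticity of a finite-dissipation Type-I singularity reaches
`(√3/KS)·(−t)^{−1/2}`.** A SINGULAR member of `𝒟_{C,K}` (any `C`, `K`) has, for every `v ≥ 0` with
`KS²v² < 3`, an instant `t < 0` with `∫⁻‖curl V(t)‖ₑ³ > v³/(√(−t))³`, i.e.
`√(−t)‖curl V(t)‖_{L³} > v`: the scale-invariant `L³`-vorticity constant `sup_t √(−t)‖ω(t)‖₃` of
the hypothetical minimal counterexample is at least `√3/KS` — the `L³` companion of the velocity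
threshold `√(−t)‖V‖_∞ ≥ 1`, the dissipation threshold `θ(K)⁴ ≥ 64/27` and the vorticity-amplitude
threshold `(−t)‖ω‖_∞ ≥ √3/4`. No DSS scenario of the catalogued wall is removed. [folklore] -/
theorem vorticityLThree_exceeds_of_singular (hV : IsTypeIAncientMild C V) {K : ℝ}
    (hK : ∀ t : ℝ, t < 0 → ∫⁻ x, ‖fderiv ℝ (V t) x‖ₑ ^ 2 ≤ ENNReal.ofReal (K / Real.sqrt (-t)))
    (hsing : ∀ r > 0, ∀ M : ℝ, ∃ t ∈ Set.Ioo (-(r ^ 2)) (0 : ℝ),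
        ∃ x ∈ Metric.ball (0 : EuclideanSpace ℝ (Fin 3)) r, M < ‖V t x‖)
    {v : ℝ} (hv0 : 0 ≤ v)
    (hv : (SNormLESNormFDerivOfEqConst (EuclideanSpace ℝ (Fin 3))
        (volume : Measure (EuclideanSpace ℝ (Fin 3))) 2 : ℝ) ^ 2 * v ^ 2 < 3) :
    ∃ t : ℝ, t < 0 ∧ ENNReal.ofReal (v ^ 3 / Real.sqrt (-t) ^ 3) < ∫⁻ x, ‖curl (V t) x‖ₑ ^ 3 := by
  by_contra h
  push Not at h
  exact not_singular_of_vorticityLThree_lt hV hK hv0 hv (fun t ht => h t ht) hsing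

end Rung

/-! ### The hyperbola: the PRODUCT of the dissipation constant and the vorticity amplitude -/

section Product

/-- **Interpolation `‖Ω‖₃³ ≤ ‖Ω‖_∞‖Ω‖₂²` on the stratum.** Under the law and the vorticity bound
`(−t)‖curl V(t,x)‖ ≤ C_ω`: `‖Ω(σ)‖³ ∈ L¹` and `∫‖Ω(σ)‖³ ≤ C_ω·‖curlCLM‖²·max K 0` for every
similarity time `σ`. [folklore] -/
theorem integrable_cube_norm_lerayVorticity_of_vorticity_le (hV : IsTypeIAncientMild C V) {K : ℝ}
    (hK : ∀ t : ℝ, t < 0 → ∫⁻ x, ‖fderiv ℝ (V t) x‖ₑ ^ 2 ≤ ENNReal.ofReal (K / Real.sqrt (-t)))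
    {Cω : ℝ} (hω : ∀ t : ℝ, t < 0 → ∀ x, (-t) * ‖curl (V t) x‖ ≤ Cω) (σ : ℝ) :
    Integrable (fun y => ‖lerayVorticity V σ y‖ ^ 3) ∧
      ∫ y, ‖lerayVorticity V σ y‖ ^ 3 ≤ Cω * (‖curlCLM‖ ^ 2 * max K 0) := by
  have hΩ : ∀ y, ‖lerayVorticity V σ y‖ ≤ Cω := fun y => norm_lerayVorticity_le_of_vorticity_le hω σ y
  have hCω0 : 0 ≤ Cω := (norm_nonneg _).trans (hΩ 0)
  obtain ⟨hint, hle⟩ := integrable_sq_norm_lerayVorticity hV hK σ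
  have hcΩ : Continuous (lerayVorticity V σ) :=
    (signedBudget_contDiff_lerayVorticity_slice hV σ (n := 1)).continuous
  have hpt : ∀ y, ‖lerayVorticity V σ y‖ ^ 3 ≤ Cω * ‖lerayVorticity V σ y‖ ^ 2 := fun y => by
    rw [pow_succ, mul_comm]
    exact mul_le_mul_of_nonneg_right (hΩ y) (sq_nonneg _)
  have hint3 : Integrable fun y => ‖lerayVorticity V σ y‖ ^ 3 :=
    (hint.const_mul Cω).mono' (hcΩ.norm.pow 3).aestronglyMeasurable
      (Eventually.of_forall fun y => by
        rw [Real.norm_of_nonneg (pow_nonneg (norm_nonneg _) 3)]; exact hpt y)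
  refine ⟨hint3, ?_⟩
  calc ∫ y, ‖lerayVorticity V σ y‖ ^ 3 ≤ ∫ y, Cω * ‖lerayVorticity V σ y‖ ^ 2 :=
        integral_mono hint3 (hint.const_mul Cω) hpt
    _ = Cω * ∫ y, ‖lerayVorticity V σ y‖ ^ 2 := integral_const_mul _ _
    _ ≤ Cω * (‖curlCLM‖ ^ 2 * max K 0) := mul_le_mul_of_nonneg_left hle hCω0

/-- **THE HYPERBOLA.** A member of `𝒟_{C,K}` (any `C`) with `(−t)‖curl V(t,x)‖ ≤ C_ω` everywhere
and `KS⁶·(C_ω·‖curlCLM‖²·max K 0)² < 27` — i.e. `KS³·‖curlCLM‖²·C_ω·K < 3√3`, a PRODUCT condition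
on the dissipation constant and the vorticity amplitude — vanishes identically on `t < 0`: with
`v = (C_ω‖curlCLM‖² max K 0)^{1/3}` the interpolation gives `∫‖Ω(σ)‖³ ≤ v³` and `KS²v² < 3`. The
region `{C_ω·K < 3√3/(KS³‖curlCLM‖²)}` is bounded by a hyperbola in the `(K, C_ω)` plane and is
contained in neither of the tree's half-planes `{C_ω < √3/4}` (`…VorticityAmplitude`, any `K`) and
`{θ(K)⁴ < 64/27}` (`…SmallDissipationGapSharper`, any `C_ω`). [folklore energy method] -/
theorem eq_zero_of_vorticity_mul_dissipation_lt (hV : IsTypeIAncientMild C V) {K : ℝ}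
    (hK : ∀ t : ℝ, t < 0 → ∫⁻ x, ‖fderiv ℝ (V t) x‖ₑ ^ 2 ≤ ENNReal.ofReal (K / Real.sqrt (-t)))
    {Cω : ℝ} (hω : ∀ t : ℝ, t < 0 → ∀ x, (-t) * ‖curl (V t) x‖ ≤ Cω)
    (hprod : (SNormLESNormFDerivOfEqConst (EuclideanSpace ℝ (Fin 3))
        (volume : Measure (EuclideanSpace ℝ (Fin 3))) 2 : ℝ) ^ 6 * (Cω * (‖curlCLM‖ ^ 2 * max K 0)) ^ 2 < 27) :
    ∀ t < 0, ∀ x, V t x = 0 := by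
  set KS : ℝ := (SNormLESNormFDerivOfEqConst (EuclideanSpace ℝ (Fin 3))
        (volume : Measure (EuclideanSpace ℝ (Fin 3))) 2 : ℝ) with hKSdef
  have hKS0 : 0 ≤ KS := NNReal.coe_nonneg _
  have hΩ3 := fun σ => integrable_cube_norm_lerayVorticity_of_vorticity_le hV hK hω σ
  set P : ℝ := Cω * (‖curlCLM‖ ^ 2 * max K 0) with hPdef
  have hP0 : 0 ≤ P := (integral_nonneg fun y => pow_nonneg (norm_nonneg _) 3).trans (hΩ3 0).2
  set v : ℝ := P ^ (1 / 3 : ℝ) with hvdef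
  have hv0 : 0 ≤ v := Real.rpow_nonneg hP0 _
  have hv3 : v ^ 3 = P := by
    rw [hvdef, ← Real.rpow_natCast, ← Real.rpow_mul hP0]; norm_num
  have hq : KS ^ 2 * v ^ 2 < 3 := by
    by_contra h
    push Not at h
    have h6 : (3 : ℝ) ^ 3 ≤ (KS ^ 2 * v ^ 2) ^ 3 := pow_le_pow_left₀ (by norm_num) h 3
    have e : (KS ^ 2 * v ^ 2) ^ 3 = KS ^ 6 * P ^ 2 := by
      rw [mul_pow, ← pow_mul, show v ^ 2 = v ^ 2 by rfl, ← pow_mul,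
        show 2 * 3 = 3 * 2 by norm_num, pow_mul v 3 2, hv3]
    rw [e] at h6
    norm_num at h6
    linarith
  exact eq_zero_of_lerayVorticity_eq_zero hV (lerayVorticity_eq_zero_of_cube_le hV hK hv0 hq
    fun σ => ⟨(hΩ3 σ).1, (hΩ3 σ).2.trans_eq hv3.symm⟩)

/-- **PORTRAIT (hyperbola form).** A SINGULAR member of `𝒟_{C,K}` with vorticity amplitude
`(−t)‖curl V‖ ≤ C_ω` has `KS⁶·(C_ω·‖curlCLM‖²·max K 0)² ≥ 27`: the product of its dissipation
constant and its vorticity amplitude is bounded BELOW by `3√3/(KS³‖curlCLM‖²)`. [folklore] -/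
theorem vorticity_mul_dissipation_ge_of_singular (hV : IsTypeIAncientMild C V) {K : ℝ}
    (hK : ∀ t : ℝ, t < 0 → ∫⁻ x, ‖fderiv ℝ (V t) x‖ₑ ^ 2 ≤ ENNReal.ofReal (K / Real.sqrt (-t)))
    (hsing : ∀ r > 0, ∀ M : ℝ, ∃ t ∈ Set.Ioo (-(r ^ 2)) (0 : ℝ),
        ∃ x ∈ Metric.ball (0 : EuclideanSpace ℝ (Fin 3)) r, M < ‖V t x‖)
    {Cω : ℝ} (hω : ∀ t : ℝ, t < 0 → ∀ x, (-t) * ‖curl (V t) x‖ ≤ Cω) :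
    27 ≤ (SNormLESNormFDerivOfEqConst (EuclideanSpace ℝ (Fin 3))
        (volume : Measure (EuclideanSpace ℝ (Fin 3))) 2 : ℝ) ^ 6 * (Cω * (‖curlCLM‖ ^ 2 * max K 0)) ^ 2 := by
  by_contra h
  push Not at h
  obtain ⟨t, ht, x, -, hM⟩ := hsing 1 one_pos 0
  have h0 := eq_zero_of_vorticity_mul_dissipation_lt hV hK hω h t ht.2 x
  rw [h0, norm_zero] at hM
  exact lt_irrefl _ hM

end Product

end Summit.NavierStokesRegularity.NavierStokesRegularity.Theorems.FiniteDissipationLiouville.VorticityLThree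

end
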